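import Summits.BirchSwinnertonDyer.BirchSwinnertonDyer.Theorems.PrintCf2RamifiedOffTYZTheoremAField
import Summits.BirchSwinnertonDyer.BirchSwinnertonDyer.Theorems.PrintCf2RamifiedOffTYZTheoremAOrderTwoLocal
import Literature.NumberTheory.EllipticCurves.HeegnerHypothesisKroneckerProofs
import Literature.NumberTheory.GaloisRepresentations.RayClassGroupFinite
import HarnessLib

/-!
# Route `PrintCf2`, crux stmt-BirchSwinnertonDyer-20509 `RamifiedOffTYZOfFacts`, THEOREM A's target (T0): transport of subfields along two
# embeddings into `ℂ`, and the arithmetic of `K_n = ℚ(√−n)` at `n = lq` needed by the assembly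
# (cell `bsd-print-cf2`, LEAD cruxlead-20509 g33, line `offtyz-v7`, lineage cycle 34; Theses-free, `def`-free; unconditional except §3, which
# takes Cox's reciprocity law `cox2013_shimuraReciprocity_rayClassField` as a hypothesis exactly like `TheoremAOrderTwoLocal`)

HONEST FRAMING (`--supports stmt-BirchSwinnertonDyer-20509`; theorems only, no `sorry`, no new named fact).  BSD is not proved by any of this;
no class is closed by this file; item 23431 (C⁺) and crux 20509 stay OPEN.

§1 TRANSPORT (pure field theory): two fields `M ⊇ ℚ` and `R ⊇ K ⊇ ℚ` embedded in `ℂ` by `j`, `e`.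
* `exists_mem_adjoin_of_image_subset` — `j(S) ⊆ e(T)` and `y ∈ ℚ(S)` give `b ∈ ℚ(T)` with `e b = j y`;
* `mem_adjoin_of_mem_fixedField` — `M/ℚ` Galois, every automorphism fixing `S` lies in `N` ⟹ `M^N ⊆ ℚ(S)`;
* `forall_exists_mem_of_adjoin_eq_top` — `K = ℚ[θ]` and `ι_K θ ∈ j(F)` ⟹ `ι_K(K) ⊆ j(F)`;
* `exists_mem_of_forall_fix` — `R/K` Galois, `e(T) ⊆ j(F)`, `e(K) ⊆ j(F)`, `r` fixed by every `K`-automorphism fixing `T` ⟹ `e r ∈ j(F)`;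
* `mem_image_of_sq_eq`, `exists_mem_eq_of_sq_eq` — square roots are located up to sign.
§2 ARITHMETIC OF `K_n` (`n = lq`, `l ≡ 1`, `q ≡ 7 (mod 8)`): `δ` odd, `θ² + bθ + ac = 0` for `Q_{n,δ} = (a, b, c)`, `w = 2θ + δ = √−n ∈ 𝓞 K_n`,
the divisors of `lq`, `ζ₄² = −1`, the Heegner hypothesis at `32`, `((l), (32)) = 1`.
§3 `((l), K^{(32)}/K)` FIXES `s₀ = s(τ_{n,δ})` for `l ≡ 1 (mod 8)` — `TheoremAOrderTwoLocal.artinSymbol_sq_mul_apply_sqrtX_eq_self` at `β₀ = 1`, `u = 1`,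
`ε = 1`, rewritten on the integral ideal `(l)` (the local half of target (T3), in the form `TheoremAOrderTwoGlobal.pow_genusClassNumber_apply_eq_self` consumes).

References: [cite: TianYuanZhang2017, §3.1 (p0010 L47–L52, L85–L89), proof of Lemma 3.21 (p0020 L55–L63)]; [cite: Cox2013, Thm. 15.17, Cor. 15.22];
[cite: Marcus2018, Ch. 2 Thm. 1]; [cite: Gross1984, §I.1]; tree: p812177 (OrderTwoLocal), TheoremAField, HeegnerHypothesisKroneckerProofs.
-/

noncomputable section

open scoped Classical nonZeroDivisors
open NumberField IsDedekindDomain Complex Polynomial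
open UpperHalfPlane hiding I

namespace Summit.BirchSwinnertonDyer.PrintCf2.TheoremAFieldTransport

open Literature.NumberTheory.EllipticCurves (heegnerTau IsImaginaryQuadratic SatisfiesHeegnerHypothesis satisfiesHeegnerHypothesis_iff_kronecker)
open Literature.NumberTheory.EllipticCurves.TianYuanZhang2017
open Literature.NumberTheory.EllipticCurves.ModularForms
open Literature.NumberTheory.NumberFields Literature.NumberTheory.GaloisRepresentations
open Literature.NumberTheory.LFunctions.AbelianDensity (artinSymbol)
open Literature.NumberTheory.ComplexMultiplication.Cox2013 (cox2013_shimuraReciprocity_rayClassField)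
open Summit.BirchSwinnertonDyer.PrintCf2.TheoremAField Summit.BirchSwinnertonDyer.PrintCf2.TheoremAOrderTwoLocal

/-! ## §1 Transport of subfields along `j : M → ℂ`, `e : R → ℂ` -/

section Transport

variable {M R : Type*} [Field M] [Algebra ℚ M] [Field R]

/-- **`j(S) ⊆ e(T)`, `y ∈ ℚ(S)` ⟹ `j y = e b` for some `b ∈ ℚ(T)`** (`j(ℚ(S)) = ℚ(j S) ⊆ ℚ(e T) = e(ℚ(T))`). [folklore] -/
theorem exists_mem_adjoin_of_image_subset [Algebra ℚ R] (j : M →+* ℂ) (e : R →+* ℂ) {S : Set M} {T : Set R} (hST : j '' S ⊆ e '' T)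
    {y : M} (hy : y ∈ IntermediateField.adjoin ℚ S) : ∃ b ∈ IntermediateField.adjoin ℚ T, e b = j y := by
  have h1 : j y ∈ (IntermediateField.adjoin ℚ S).map j.toRatAlgHom := ⟨y, hy, rfl⟩
  rw [IntermediateField.adjoin_map] at h1
  have h2 : IntermediateField.adjoin ℚ (j.toRatAlgHom '' S) ≤ (IntermediateField.adjoin ℚ T).map e.toRatAlgHom := by
    rw [IntermediateField.adjoin_map]
    exact IntermediateField.adjoin.mono ℚ _ _ hST
  obtain ⟨r, hr, hre⟩ := h2 h1
  exact ⟨r, hr, hre⟩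

/-- **`M^N ⊆ ℚ(S)`** when `M/ℚ` is Galois and every automorphism fixing `S` pointwise lies in `N` (`Fix(ℚ(S)) ≤ N`, Galois correspondence). [folklore] -/
theorem mem_adjoin_of_mem_fixedField [IsGalois ℚ M] [FiniteDimensional ℚ M] (N : Subgroup (M ≃ₐ[ℚ] M)) (S : Set M)
    (hS : ∀ g : M ≃ₐ[ℚ] M, (∀ s ∈ S, g s = s) → g ∈ N) {m : M} (hm : m ∈ IntermediateField.fixedField N) :
    m ∈ IntermediateField.adjoin ℚ S := by
  rw [← IsGalois.fixedField_fixingSubgroup (IntermediateField.adjoin ℚ S), IntermediateField.mem_fixedField_iff]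
  intro g hg
  rw [IntermediateField.mem_fixingSubgroup_iff] at hg
  exact (IntermediateField.mem_fixedField_iff _ _ |>.mp hm) g (hS g fun s hs => hg s (IntermediateField.subset_adjoin ℚ S hs))

/-- **`K = ℚ[θ]` and `ι θ ∈ j(F)` ⟹ `ι(K) ⊆ j(F)`**: the elements of `K` whose image lies in `j(F)` form a `ℚ`-subalgebra containing `θ`. [folklore] -/
theorem forall_exists_mem_of_adjoin_eq_top {K : Type*} [Field K] [Algebra ℚ K] (ι : K →+* ℂ) (j : M →+* ℂ) (F : IntermediateField ℚ M)
    {θ : K} (hθ : Algebra.adjoin ℚ {θ} = ⊤) (h : ∃ m ∈ F, j m = ι θ) : ∀ k : K, ∃ m ∈ F, j m = ι k := by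
  let A : Subalgebra ℚ K :=
    { carrier := {k | ∃ m ∈ F, j m = ι k}
      mul_mem' := by
        rintro x y ⟨m, hm, hmx⟩ ⟨m', hm', hmy⟩
        exact ⟨m * m', mul_mem hm hm', by rw [map_mul, map_mul, hmx, hmy]⟩
      one_mem' := ⟨1, one_mem _, by rw [map_one, map_one]⟩
      add_mem' := by
        rintro x y ⟨m, hm, hmx⟩ ⟨m', hm', hmy⟩
        exact ⟨m + m', add_mem hm hm', by rw [map_add, map_add, hmx, hmy]⟩
      zero_mem' := ⟨0, zero_mem _, by rw [map_zero, map_zero]⟩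
      algebraMap_mem' := fun c => ⟨algebraMap ℚ M c, algebraMap_mem F c, by rw [eq_ratCast, eq_ratCast, map_ratCast, map_ratCast]⟩ }
  have hA : (⊤ : Subalgebra ℚ K) ≤ A := by
    rw [← hθ]
    exact Algebra.adjoin_le (Set.singleton_subset_iff.mpr h)
  intro k
  exact hA Algebra.mem_top

/-- **`e(T) ⊆ j(F)`, `e(K) ⊆ j(F)`, `r ∈ R` fixed by every `K`-automorphism fixing `T` ⟹ `e r ∈ j(F)`** (`R/K` Galois: `r ∈ K(T)`, and the elements
of `R` whose image lies in `j(F)` form an intermediate field containing `T`). [folklore] -/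
theorem exists_mem_of_forall_fix {K : Type*} [Field K] [Algebra K R] [FiniteDimensional K R] [IsGalois K R]
    (j : M →+* ℂ) (e : R →+* ℂ) (F : IntermediateField ℚ M) (T : Set R)
    (hT : ∀ t ∈ T, ∃ m ∈ F, j m = e t) (hK : ∀ k : K, ∃ m ∈ F, j m = e (algebraMap K R k))
    (r : R) (hr : ∀ g : R ≃ₐ[K] R, (∀ t ∈ T, g t = t) → g r = r) : ∃ m ∈ F, j m = e r := by
  let E : IntermediateField K R :=
    { carrier := {r | ∃ m ∈ F, j m = e r}
      mul_mem' := by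
        rintro x y ⟨m, hm, hmx⟩ ⟨m', hm', hmy⟩
        exact ⟨m * m', mul_mem hm hm', by rw [map_mul, map_mul, hmx, hmy]⟩
      one_mem' := ⟨1, one_mem _, by rw [map_one, map_one]⟩
      add_mem' := by
        rintro x y ⟨m, hm, hmx⟩ ⟨m', hm', hmy⟩
        exact ⟨m + m', add_mem hm hm', by rw [map_add, map_add, hmx, hmy]⟩
      zero_mem' := ⟨0, zero_mem _, by rw [map_zero, map_zero]⟩
      algebraMap_mem' := hK
      inv_mem' := by
        rintro x ⟨m, hm, hmx⟩
        exact ⟨m⁻¹, inv_mem hm, by rw [map_inv₀, map_inv₀, hmx]⟩ }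
  have hle : IntermediateField.adjoin K T ≤ E := IntermediateField.adjoin_le_iff.mpr fun t ht => hT t ht
  have hr' : r ∈ IntermediateField.adjoin K T := by
    rw [← IsGalois.fixedField_fixingSubgroup (IntermediateField.adjoin K T), IntermediateField.mem_fixedField_iff]
    intro g hg
    rw [IntermediateField.mem_fixingSubgroup_iff] at hg
    exact hr g fun t ht => hg t (IntermediateField.subset_adjoin K T ht)
  exact hle hr'

/-- `x² = (e t)²` with `t` and `−t` in `E` ⟹ `x ∈ e(E)`. [folklore] -/
theorem mem_image_of_sq_eq (e : R →+* ℂ) {E : Set R} (hneg : ∀ t ∈ E, -t ∈ E) {x : ℂ} {t : R} (ht : t ∈ E)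
    (h : x ^ 2 = e t ^ 2) : x ∈ e '' E := by
  rcases sq_eq_sq_iff_eq_or_eq_neg.mp h with h | h
  · exact ⟨t, ht, h.symm⟩
  · exact ⟨-t, hneg t ht, by rw [map_neg, h]⟩

/-- `x² = (j s)²` with `s` in a subfield `F` ⟹ `x = j m` for some `m ∈ F`. [folklore] -/
theorem exists_mem_eq_of_sq_eq (j : M →+* ℂ) {F : IntermediateField ℚ M} {x : ℂ} {s : M} (hs : s ∈ F) (h : x ^ 2 = j s ^ 2) :
    ∃ m ∈ F, j m = x := by
  rcases sq_eq_sq_iff_eq_or_eq_neg.mp h with h | h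
  · exact ⟨s, hs, h.symm⟩
  · exact ⟨-s, neg_mem hs, by rw [map_neg, h]⟩

end Transport

/-! ## §2 Arithmetic of `K_n = ℚ(√−n)` at `n = lq` -/

/-- `128 ∣ n + δ²` with `n` odd forces `δ` odd. [folklore] -/
theorem odd_of_dvd_add_sq {n : ℕ} (hn : Odd n) {δ : ℤ} (h : (128 : ℤ) ∣ (n : ℤ) + δ ^ 2) : Odd δ := by
  have h2 : Even ((n : ℤ) + δ ^ 2) := by
    obtain ⟨m, hm⟩ := h
    exact ⟨64 * m, by rw [hm]; ring⟩
  have hn' : Odd (n : ℤ) := by exact_mod_cast hn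
  by_contra hδ
  rw [Int.not_odd_iff_even] at hδ
  exact (Int.not_even_iff_odd.mpr (hn'.add_even (hδ.pow_of_ne_zero two_ne_zero))) h2

/-- **`θ² + bθ + ac = 0`** for `θ = (−δ + √−n)/2` and `Q_{n,δ} = (a, b, c) = ((n+δ²)/4, δ, 1)`. [cite: Cox2013, Thm. 15.17 (θ = aτ₀)] -/
theorem theta_rel {n : ℕ} (hn : 1 ≤ n) {δ : ℤ} (h128 : (128 : ℤ) ∣ (n : ℤ) + δ ^ 2) {θ : 𝓞 (GenusField n)}
    (hθ : ((θ : GenusField n)) = (-(δ : GenusField n) + AdjoinRoot.root (genusFieldPoly n)) / 2) :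
    (θ : GenusField n) ^ 2 + (sevenBlockForm n δ).2.1 * (θ : GenusField n) + (sevenBlockForm n δ).1 * (sevenBlockForm n δ).2.2 = 0 := by
  have h4 : (4 : ℤ) ∣ (n : ℤ) + δ ^ 2 := (show (4 : ℤ) ∣ 128 by norm_num).trans h128
  have h4a : (4 : GenusField n) * ((sevenBlockForm n δ).1 : GenusField n) = (n : GenusField n) + (δ : GenusField n) ^ 2 := by
    have := four_mul_sevenBlockForm_fst h4
    exact_mod_cast congrArg (fun z : ℤ => (z : GenusField n)) this
  have hroot := root_genusField_sq hn
  rw [(sevenBlockForm_apply n δ).2.1, (sevenBlockForm_apply n δ).2.2, hθ]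
  push_cast
  linear_combination (1 / 4 : GenusField n) * hroot + (1 / 4 : GenusField n) * h4a

/-- **`w = θ + θ + δ = √−n ∈ 𝓞 K_n`**: its image in `K_n` is the root. [folklore] -/
theorem coe_two_mul_theta_add {n : ℕ} {δ : ℤ} {θ : 𝓞 (GenusField n)}
    (hθ : ((θ : GenusField n)) = (-(δ : GenusField n) + AdjoinRoot.root (genusFieldPoly n)) / 2) :
    (((θ + θ + (δ : 𝓞 (GenusField n)) : 𝓞 (GenusField n))) : GenusField n) = AdjoinRoot.root (genusFieldPoly n) := by
  have e1 : (((θ + θ + (δ : 𝓞 (GenusField n)) : 𝓞 (GenusField n))) : GenusField n) =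
      (θ : GenusField n) + (θ : GenusField n) + (δ : GenusField n) := rfl
  rw [e1, hθ]; ring

/-- **`w² = −n` in `𝓞 K_n`** for `w = θ + θ + δ`. [folklore] -/
theorem sq_two_mul_theta_add {n : ℕ} (hn : 1 ≤ n) {δ : ℤ} {θ : 𝓞 (GenusField n)}
    (hθ : ((θ : GenusField n)) = (-(δ : GenusField n) + AdjoinRoot.root (genusFieldPoly n)) / 2) :
    ((θ + θ + (δ : 𝓞 (GenusField n))) : 𝓞 (GenusField n)) ^ 2 = -((n : ℕ) : 𝓞 (GenusField n)) := by
  apply NumberField.RingOfIntegers.ext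
  have h := coe_two_mul_theta_add hθ
  have e1 : ((((θ + θ + (δ : 𝓞 (GenusField n))) : 𝓞 (GenusField n)) ^ 2 : 𝓞 (GenusField n)) : GenusField n) =
      ((((θ + θ + (δ : 𝓞 (GenusField n))) : 𝓞 (GenusField n))) : GenusField n) ^ 2 := rfl
  have e2 : (((-((n : ℕ) : 𝓞 (GenusField n))) : 𝓞 (GenusField n)) : GenusField n) = -((n : ℕ) : GenusField n) := rfl
  rw [e1, e2, h, root_genusField_sq hn]

/-- The divisors `> 1` of `lq` (`l ≠ q` primes) are `l`, `q`, `lq`. [folklore] -/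
theorem eq_of_dvd_prime_mul_prime {l q : ℕ} (hl : l.Prime) (hq : q.Prime) {d : ℕ} (hd : d ∣ l * q) (h1 : 1 < d) :
    d = l ∨ d = q ∨ d = l * q := by
  obtain ⟨d₁, d₂, hd₁, hd₂, rfl⟩ := Nat.dvd_mul.mp hd
  rcases (Nat.dvd_prime hl).mp hd₁ with rfl | rfl <;> rcases (Nat.dvd_prime hq).mp hd₂ with rfl | rfl
  · omega
  · right; left; ring
  · left; ring
  · right; right; rfl

/-- A primitive fourth root of unity in a domain squares to `−1`. [folklore] -/
theorem sq_eq_neg_one_of_isPrimitiveRoot_four {S : Type*} [CommRing S] [IsDomain S] {ζ : S} (hζ : IsPrimitiveRoot ζ 4) : ζ ^ 2 = -1 := by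
  have h4 : ζ ^ 4 = 1 := hζ.pow_eq_one
  have h2 : ζ ^ 2 ≠ 1 := hζ.pow_ne_one_of_pos_of_lt (by norm_num) (by norm_num)
  have hfac : (ζ ^ 2 - 1) * (ζ ^ 2 + 1) = 0 := by
    have : ζ ^ 4 - 1 = 0 := by rw [h4, sub_self]
    linear_combination this
  rcases mul_eq_zero.mp hfac with h | h
  · exact absurd (sub_eq_zero.mp h) h2
  · exact eq_neg_of_add_eq_zero_left h

/-- **The Heegner hypothesis at `N = 32` for `K_n`, `n ≡ 7 (mod 8)` square-free**: `d_K = −n ≡ 1 (mod 8)`, so `2` splits. [cite: Gross1984, §I.1] -/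
theorem satisfiesHeegnerHypothesis_genusField {n : ℕ} (hn1 : 1 < n) (hn7 : n % 8 = 7) (hsq : Squarefree n) :
    SatisfiesHeegnerHypothesis 32 (GenusField n) := by
  rw [satisfiesHeegnerHypothesis_iff_kronecker (h2 := finrank_genusField n)]
  intro p hp hp32
  have hp2 : p = 2 := (Nat.prime_dvd_prime_iff_eq hp Nat.prime_two).mp (hp.dvd_of_dvd_pow (show p ∣ 2 ^ 5 by simpa using hp32))
  refine ⟨fun _ => ?_, fun h => absurd hp2 h⟩
  rw [discr_genusField hn1 (by omega) hsq]
  omega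

/-- `((l), (32)) = 1` in any commutative ring for odd `l`. [folklore] -/
theorem isCoprime_span_natCast_span {S : Type*} [CommRing S] {l : ℕ} (hl : Odd l) :
    IsCoprime (Ideal.span {((l : ℕ) : S)}) (Ideal.span {((32 : ℕ) : S)}) := by
  rw [Ideal.isCoprime_span_singleton_iff]
  have h : Nat.Coprime l 32 := Nat.Coprime.pow_right 5 hl.coprime_two_right
  exact h.cast

/-! ## §3 `((l), K^{(32)}/K)` fixes `s(τ_Q)` for `l ≡ 1 (mod 8)` -/

/-- **`((l), K^{(32)}/K) s₀ = s₀` for a rational integer `l ≡ 1 (mod 8)`**, where `e s₀ = s(τ_Q)`, `s = η-quotient rS`, `Q = (a, b, c)` with `32 ∣ a`,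
`𝓞 K = ℤ + ℤθ`, `θ = aτ_Q`: the case `β₀ = 1`, `u = 1`, `ε = 1` of `TheoremAOrderTwoLocal.artinSymbol_sq_mul_apply_sqrtX_eq_self` (`χ₈(l) = 1`), rewritten on
the integral ideal `(l)` (`artinHom_toPrincipalIdeal_coe`), GRANTED Cox's reciprocity law. [cite: Cox2013, Thm. 15.17, Cor. 15.22]
[cite: TianYuanZhang2017, proof of Lemma 3.21 (p0020 L55–L63)] -/
theorem artinSymbol_span_apply_eq_self (h : cox2013_shimuraReciprocity_rayClassField)
    (K : Type) [Field K] [NumberField K] (ι : K →+* ℂ) (hK : IsImaginaryQuadratic K)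
    (a b c : ℤ) (ha : 0 < a) (hD : b ^ 2 - 4 * a * c < 0) (hprim : Int.gcd (Int.gcd a b) c = 1) (h32 : (32 : ℤ) ∣ a)
    (θ : 𝓞 K) (hθ : ι (θ : K) = (a : ℂ) * ((heegnerTau (a, b, c) : ℍ) : ℂ)) (hθrel : (θ : K) ^ 2 + b * (θ : K) + a * c = 0)
    (hgen : ∀ z : 𝓞 K, ∃ A B : ℤ, (z : K) = A + B * (θ : K))
    (e : rayClassField K (Ideal.span {((32 : ℕ) : 𝓞 K)}) →+* ℂ)
    (he : ∀ k : K, e (algebraMap K (rayClassField K (Ideal.span {((32 : ℕ) : 𝓞 K)})) k) = ι k)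
    {l : ℕ} (hl : l % 8 = 1)
    (y : rayClassField K (Ideal.span {((32 : ℕ) : 𝓞 K)})) (hy : e y = etaQuotient 32 rS (heegnerTau (a, b, c))) :
    artinSymbol (galFrob K (rayClassField K (Ideal.span {((32 : ℕ) : 𝓞 K)}))) (Ideal.span {((l : ℕ) : 𝓞 K)}) y = y := by
  have hl0 : l ≠ 0 := by rintro rfl; norm_num at hl
  have hb0 : ((((1 * (l : ℤ) ^ 1 : ℤ) : 𝓞 K) * (1 : 𝓞 K) ^ 2 : 𝓞 K)) = ((l : ℕ) : 𝓞 K) := by push_cast; ring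
  have hne : ((((1 * (l : ℤ) ^ 1 : ℤ) : 𝓞 K) * (1 : 𝓞 K) ^ 2 : 𝓞 K)) ≠ 0 := by
    rw [hb0]; exact_mod_cast hl0
  have hγ : (((((1 * (l : ℤ) ^ 1 : ℤ) : 𝓞 K) * (1 : 𝓞 K) ^ 2 : 𝓞 K)) : K) ≠ 0 := by exact_mod_cast hne
  have h32ne : (Ideal.span {((32 : ℕ) : 𝓞 K)} : Ideal (𝓞 K)) ≠ ⊥ := by
    rw [Ne, Ideal.span_singleton_eq_bot]; exact_mod_cast (by norm_num : (32 : ℕ) ≠ 0)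
  have hγm : toPrincipalIdeal (𝓞 K) K (Units.mk0 _ hγ) ∈ idealsPrimeTo (Ideal.span {((32 : ℕ) : 𝓞 K)}) := by
    rw [toPrincipalIdeal_unitsMk0_coe hne]
    refine unitsMk0_coeIdeal_mem_idealsPrimeTo h32ne ?_ ?_
    · rw [Ne, Ideal.span_singleton_eq_bot]; exact hne
    · rw [hb0]; exact isCoprime_span_natCast_span (Nat.odd_iff.mpr (by omega))
  have hmain := artinSymbol_sq_mul_apply_sqrtX_eq_self h K ι hK a b c ha hD hprim h32 θ hθ hθrel hgen e he 1 1 0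
    (by push_cast; ring) ⟨0, by ring⟩ 1 (l : ℤ) (Or.inl rfl) (by omega) 1 hγ hγm y hy
  rw [artinHom_toPrincipalIdeal_coe _ hne, hb0] at hmain
  exact hmain

end Summit.BirchSwinnertonDyer.PrintCf2.TheoremAFieldTransport

end
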